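import Mathlib
import Summits.Schanuel.Schanuel.Theses.RigidCore
import Literature.NumberTheory.Transcendental.LindemannWeierstrassProofs

/-!
# RigidCore / EndomorphismMovingLogTwo — an exponential ring endomorphism of `ℂ` moving `ln 2`
forces the algebraic independence of `π` and `log 2`

Settles item stmt-Schanuel-0973 (route `Schanuel/RigidCore`, support
`Summit.Schanuel.Schanuel.Theses.RigidCore.EndomorphismMovingLogTwo`):
if some ring endomorphism `j : ℂ →+* ℂ` commuting with `exp` moves `ln 2`, then `π` and `log 2`
are algebraically independent over `ℚ`.

Proof (card branch-indiscernibility-rigid-core-v3, T1; Nathanson arXiv:2209.01027 Thm 2 for the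
`mod 2πiℤ` bookkeeping; Lindemann 1882 for the transcendence of `π`, PROVED in the tree as
`Literature.NumberTheory.Transcendental.transcendental_pi_holds`):

* `exp (j (2πi)) = j 1 = 1`, so `j (2πi) = 2πi·m`; injectivity of `j` on roots of unity forces
  `m = ±1` (`map_two_pi_I_eq_or`); composing with complex conjugation if `m = -1` we may assume
  `j (2πi) = 2πi` (`exists_fixing_two_pi_I`);
* then `j π = ±π` and `j (ln 2) = ln 2 + 2πik` with `k ≠ 0`, so `j² := j ∘ j` fixes `π` and
  shifts `ln 2` by `c := 4πik ≠ 0` with `j² c = c` (`exists_fixing_pi_shifting_log_two`);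
* the orbit `ln 2 + n c` is infinite, so `ln 2` is transcendental over the fixed subalgebra of
  `j²`, which contains `ℚ[π]` (`transcendental_of_shift`);
* with `π` transcendental over `ℚ` this is the algebraic independence of `(π, log 2)`
  (`AlgebraicIndependent.option_iff_transcendental`).

No named fact is taken as a hypothesis: the only transcendence input is the discharged
`transcendental_pi_holds`.
-/

-- D-0017: single-problem summit ⇒ namespace `Summit.Schanuel.Schanuel.…` by design (cf. lakefile `leanOptions`).
set_option linter.dupNamespace false

namespace Summit.Schanuel.Schanuel.Theorems

open Complex Polynomial
open scoped Real

/-- `exp (ln 2) = 2` in `ℂ`, with `ln 2` the real logarithm coerced to `ℂ`. [folklore] -/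
theorem cexp_ofReal_log_two : Complex.exp ((Real.log 2 : ℝ) : ℂ) = 2 := by
  rw [← Complex.ofReal_exp, Real.exp_log (by norm_num : (0 : ℝ) < 2)]
  norm_num

/-- Nathanson's observation (arXiv:2209.01027, Thm 2, for `t = 2`): an `exp`-commuting ring
endomorphism of `ℂ` moves `ln 2` by an integer multiple of `2πi`. [folklore] -/
theorem exists_int_map_log_two (j : ℂ →+* ℂ)
    (hj : ∀ z : ℂ, j (Complex.exp z) = Complex.exp (j z)) :
    ∃ k : ℤ, j ((Real.log 2 : ℝ) : ℂ) = ((Real.log 2 : ℝ) : ℂ) + k * (2 * π * I) := by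
  rw [← Complex.exp_eq_exp_iff_exists_int, ← hj, cexp_ofReal_log_two, map_ofNat]

/-- An `exp`-commuting ring endomorphism of `ℂ` maps `2πi` to `±2πi`: `exp (j (2πi)) = 1` gives
`j (2πi) = 2πi·m`, and for `|m| ≥ 2` the primitive `|m|`-th root of unity `exp (2πi/|m|)` would be
mapped to `1 = j 1`, contradicting injectivity; `m = 0` contradicts injectivity as well.
[folklore] -/
theorem map_two_pi_I_eq_or (j : ℂ →+* ℂ)
    (hj : ∀ z : ℂ, j (Complex.exp z) = Complex.exp (j z)) :
    j (2 * π * I) = 2 * π * I ∨ j (2 * π * I) = -(2 * π * I) := by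
  obtain ⟨m, hm⟩ : ∃ m : ℤ, j (2 * π * I) = m * (2 * π * I) := by
    rw [← Complex.exp_eq_one_iff, ← hj, Complex.exp_two_pi_mul_I, map_one]
  have hinj := j.injective
  rcases Nat.lt_trichotomy m.natAbs 1 with h | h | h
  · -- `m = 0`: then `j (2πi) = 0`, impossible
    exfalso
    have hm0 : m = 0 := by omega
    rw [hm0, Int.cast_zero, zero_mul, map_eq_zero_iff j hinj] at hm
    exact Complex.two_pi_I_ne_zero hm
  · -- `|m| = 1`
    have h1 : m = 1 ∨ m = -1 := by omega
    rcases h1 with h1 | h1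
    · left
      rw [hm, h1]
      simp
    · right
      rw [hm, h1]
      simp
  · -- `|m| ≥ 2`: the primitive root `exp (2πi / |m|)` is sent to `1`
    exfalso
    set N := m.natAbs with hN
    have hN0 : N ≠ 0 := by omega
    have hζ := Complex.isPrimitiveRoot_exp N hN0
    apply hζ.ne_one h
    apply hinj
    rw [map_one, hj, map_div₀, hm, map_natCast]
    have hNC : (N : ℂ) ≠ 0 := by exact_mod_cast hN0
    have hmz : m.sign * (N : ℤ) = m := by rw [hN]; exact Int.sign_mul_natAbs m
    have hmN : (m : ℂ) = ((m.sign : ℤ) : ℂ) * (N : ℂ) := by exact_mod_cast hmz.symm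
    have : (m : ℂ) * (2 * π * I) / (N : ℂ) = ((m.sign : ℤ) : ℂ) * (2 * π * I) := by
      rw [hmN]
      field_simp
    rw [this]
    exact Complex.exp_int_mul_two_pi_mul_I m.sign

/-- Normalisation, step 1: if an `exp`-commuting ring endomorphism of `ℂ` moves `ln 2`, then one
(it, or its composite with complex conjugation) moves `ln 2` and FIXES `2πi`. [folklore] -/
theorem exists_fixing_two_pi_I (j : ℂ →+* ℂ)
    (hj : ∀ z : ℂ, j (Complex.exp z) = Complex.exp (j z))
    (hjL : j ((Real.log 2 : ℝ) : ℂ) ≠ ((Real.log 2 : ℝ) : ℂ)) :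
    ∃ j' : ℂ →+* ℂ, (∀ z : ℂ, j' (Complex.exp z) = Complex.exp (j' z)) ∧
      j' (2 * π * I) = 2 * π * I ∧ j' ((Real.log 2 : ℝ) : ℂ) ≠ ((Real.log 2 : ℝ) : ℂ) := by
  rcases map_two_pi_I_eq_or j hj with h | h
  · exact ⟨j, hj, h, hjL⟩
  · refine ⟨(starRingEnd ℂ).comp j, fun z => ?_, ?_, ?_⟩
    · rw [RingHom.comp_apply, RingHom.comp_apply, hj, Complex.exp_conj]
    · rw [RingHom.comp_apply, h, map_neg, map_mul, map_mul, map_ofNat, Complex.conj_ofReal,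
        Complex.conj_I]
      ring
    · intro h'
      apply hjL
      rw [RingHom.comp_apply] at h'
      rw [← Complex.conj_conj (j _), h', Complex.conj_ofReal]

/-- A ring endomorphism of `ℂ` fixing `2πi` maps `π` to `±π` (as `j i = ± i`). [folklore] -/
theorem map_pi_eq_or (j : ℂ →+* ℂ) (h : j (2 * π * I) = 2 * π * I) :
    j (π : ℂ) = π ∨ j (π : ℂ) = -π := by
  have hI : j I = I ∨ j I = -I := by
    have : (j I) ^ 2 = I ^ 2 := by rw [← map_pow, Complex.I_sq, map_neg, map_one]
    exact sq_eq_sq_iff_eq_or_eq_neg.mp this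
  rw [map_mul, map_mul, map_ofNat] at h
  rcases hI with hI | hI
  · left
    rw [hI] at h
    exact mul_left_cancel₀ two_ne_zero (mul_right_cancel₀ Complex.I_ne_zero h)
  · right
    rw [hI] at h
    have h' : (2 : ℂ) * j π * -I = 2 * (-π) * -I := by rw [h]; ring
    exact mul_left_cancel₀ two_ne_zero (mul_right_cancel₀ (neg_ne_zero.mpr Complex.I_ne_zero) h')

/-- Normalisation, step 2: if an `exp`-commuting ring endomorphism of `ℂ` moves `ln 2`, then some
ring endomorphism `j₂` of `ℂ` (the square of the one from `exists_fixing_two_pi_I`) fixes `π` and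
translates `ln 2` by a non-zero `j₂`-fixed constant `c` (namely `c = 4πik`). [folklore] -/
theorem exists_fixing_pi_shifting_log_two (j : ℂ →+* ℂ)
    (hj : ∀ z : ℂ, j (Complex.exp z) = Complex.exp (j z))
    (hjL : j ((Real.log 2 : ℝ) : ℂ) ≠ ((Real.log 2 : ℝ) : ℂ)) :
    ∃ j₂ : ℂ →+* ℂ, j₂ (π : ℂ) = π ∧ ∃ c : ℂ, c ≠ 0 ∧ j₂ c = c ∧
      j₂ ((Real.log 2 : ℝ) : ℂ) = ((Real.log 2 : ℝ) : ℂ) + c := by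
  obtain ⟨j', hj', h2πI, hj'L⟩ := exists_fixing_two_pi_I j hj hjL
  obtain ⟨k, hk⟩ := exists_int_map_log_two j' hj'
  have hk0 : k ≠ 0 := by
    rintro rfl
    apply hj'L
    rw [hk]
    simp
  have hkτ : ∀ z : ℤ, j' ((z : ℂ) * (2 * π * I)) = (z : ℂ) * (2 * π * I) := fun z => by
    rw [map_mul, map_intCast, h2πI]
  refine ⟨j'.comp j', ?_, ((2 * k : ℤ) : ℂ) * (2 * π * I), ?_, ?_, ?_⟩
  · rcases map_pi_eq_or j' h2πI with hπ | hπ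
    · rw [RingHom.comp_apply, hπ, hπ]
    · rw [RingHom.comp_apply, hπ, map_neg, hπ, neg_neg]
  · refine mul_ne_zero ?_ Complex.two_pi_I_ne_zero
    exact_mod_cast mul_ne_zero two_ne_zero hk0
  · rw [RingHom.comp_apply, hkτ, hkτ]
  · rw [RingHom.comp_apply, hk, map_add, hk, hkτ]
    push_cast
    ring

/-- Infinite-orbit argument: if a ring endomorphism `j` of `ℂ` fixes a `ℚ`-subalgebra `F`
pointwise and translates `L` by a non-zero `j`-fixed constant `c`, then `L` is transcendental over
`F` — a polynomial over `F` vanishing at `L` vanishes on the whole orbit `L + ℕ c`. [folklore] -/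
theorem transcendental_of_shift (j : ℂ →+* ℂ) (F : Subalgebra ℚ ℂ) (hF : ∀ x ∈ F, j x = x)
    (L c : ℂ) (hc : c ≠ 0) (hjc : j c = c) (hjL : j L = L + c) : Transcendental F L := by
  rintro ⟨p, hp0, hpL⟩
  let jA : ℂ →ₐ[F] ℂ := { j with commutes' := fun r => hF r.1 r.2 }
  have horbit : ∀ n : ℕ, Polynomial.aeval (L + n * c) p = 0 := by
    intro n
    induction n with
    | zero => simpa using hpL
    | succ n ih =>
      have hstep : L + ((n + 1 : ℕ) : ℂ) * c = jA (L + n * c) := by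
        show _ = j (L + n * c)
        rw [map_add, hjL, map_mul, map_natCast, hjc]
        push_cast
        ring
      rw [hstep, Polynomial.aeval_algHom_apply, ih, map_zero]
  have hinj : Function.Injective (fun n : ℕ => L + n * c) := fun a b hab => by
    have h1 : (a : ℂ) * c = b * c := add_left_cancel hab
    exact_mod_cast mul_right_cancel₀ hc h1
  have hinf : Set.Infinite {x : ℂ | (p.map (algebraMap F ℂ)).IsRoot x} := by
    refine Set.infinite_of_injective_forall_mem hinj (fun n => ?_)
    show (p.map (algebraMap F ℂ)).IsRoot (L + n * c)
    rw [Polynomial.IsRoot, Polynomial.eval_map, ← Polynomial.aeval_def, horbit n]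
  have hp : p.map (algebraMap F ℂ) = 0 := Polynomial.eq_zero_of_infinite_isRoot _ hinf
  rw [Polynomial.map_eq_zero_iff] at hp
  · exact hp0 hp
  · exact fun a b h => Subtype.ext h

/-- `π ∈ ℂ` is transcendental over `ℚ` (Lindemann 1882; the tree's discharged fact
`Literature.NumberTheory.Transcendental.transcendental_pi_holds`, transported along `ℝ → ℂ`).
[folklore] -/
theorem transcendental_pi_complex : Transcendental ℚ (π : ℂ) := fun hc =>
  Literature.NumberTheory.Transcendental.transcendental_pi_holds
    ((isAlgebraic_algebraMap_iff (algebraMap ℝ ℂ).injective).mp hc)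

/-- Settles stmt-Schanuel-0973: ONE `exp`-commuting ring endomorphism of `ℂ` moving `ln 2`
makes `π` and `log 2` algebraically independent over `ℚ` (contrapositive: if `π, log 2` are
algebraically dependent, every exponential ring endomorphism of `ℂ` fixes `ln 2` — Mycielski's
question, Nathanson arXiv:2209.01027 §4, as a transcendence criterion). Uses only the discharged
Lindemann fact `transcendental_pi_holds`. [folklore] -/
theorem EndomorphismMovingLogTwo_proof :
    Summit.Schanuel.Schanuel.Theses.RigidCore.EndomorphismMovingLogTwo := by
  unfold Summit.Schanuel.Schanuel.Theses.RigidCore.EndomorphismMovingLogTwo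
  rintro ⟨j, hj, hjL⟩
  obtain ⟨j₂, hπ, c, hc, hjc, hL⟩ := exists_fixing_pi_shifting_log_two j hj hjL
  -- the fixed subalgebra of `j₂` contains `ℚ[π]`, and `ln 2` is transcendental over it
  let F : Subalgebra ℚ ℂ := AlgHom.equalizer j₂.toRatAlgHom (AlgHom.id ℚ ℂ)
  have hF : ∀ x ∈ F, j₂ x = x := fun x hx => by simpa [F] using hx
  have hLt : Transcendental F ((Real.log 2 : ℝ) : ℂ) :=
    transcendental_of_shift j₂ F hF _ c hc hjc hL
  have hπF : Algebra.adjoin ℚ (Set.range ![(π : ℂ)]) ≤ F := by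
    refine Algebra.adjoin_le ?_
    rintro _ ⟨i, rfl⟩
    have hi : ![(π : ℂ)] i = π := by fin_cases i; rfl
    simpa [F, hi] using hπ
  have hLt' : Transcendental (Algebra.adjoin ℚ (Set.range ![(π : ℂ)])) ((Real.log 2 : ℝ) : ℂ) :=
    hLt.of_tower_top_of_subalgebra_le hπF
  have hind : AlgebraicIndependent ℚ ![(π : ℂ)] :=
    algebraicIndependent_iff_transcendental.mpr transcendental_pi_complex
  have hopt := (hind.option_iff_transcendental ((Real.log 2 : ℝ) : ℂ)).mpr hLt'
  -- reindex `Option (Fin 1) ≃ Fin 2`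
  have hfun : ((fun o : Option (Fin 1) => o.elim ((Real.log 2 : ℝ) : ℂ) ![(π : ℂ)]) ∘
      (![some 0, none] : Fin 2 → Option (Fin 1))) = ![(π : ℂ), ((Real.log 2 : ℝ) : ℂ)] := by
    funext i
    fin_cases i <;> rfl
  have hinj : Function.Injective (![some 0, none] : Fin 2 → Option (Fin 1)) := by decide
  have hcomp := hopt.comp _ hinj
  rw [hfun] at hcomp
  exact hcomp

end Summit.Schanuel.Schanuel.Theorems
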